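import Mathlib.Topology.Covering.Basic
import Mathlib.Topology.Maps.Proper.Basic
import HarnessLib

/-!
# A covering map with finite fibres is proper

Layer `Literature/Topology/CoveringSpaces`. A covering map `q : E → X` all of whose fibres are finite
is a proper map (`IsCoveringMap.isProperMap_of_finite`): if an ultrafilter `𝒰` on `E` has
`q_* 𝒰 → y`, then over an evenly covered neighbourhood `U ∋ y`, `q⁻¹ U ≅ U × q⁻¹{y}` with `q⁻¹{y}`
finite, so `𝒰` concentrates on one sheet `U × {i}` and converges to the point of that sheet over
`y` (folklore; Forster, *Lectures on Riemann Surfaces*, §4 Thm. 4.22 is the converse direction: a proper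
local homeomorphism is a finite covering).

Everything is proved; there are no definitions.

## References

* O. Forster, *Lectures on Riemann Surfaces*, GTM 81 (1981), §4.21–4.22. [Forster1981]
-/

open Set Filter Topology Function

namespace Literature.Topology.CoveringSpaces

variable {E X : Type*} [TopologicalSpace E] [TopologicalSpace X] {q : E → X}

/-- Over an evenly covered point with EMPTY fibre, a whole neighbourhood has empty preimage, so no
ultrafilter on `E` can be pushed to a filter converging to that point. [folklore] -/
theorem IsEvenlyCovered.not_tendsto_of_isEmpty {y : X} {I : Type*} [TopologicalSpace I] [IsEmpty I]
    (h : IsEvenlyCovered q y I) (𝒰 : Ultrafilter E) : ¬ Tendsto q (𝒰 : Filter E) (𝓝 y) := by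
  intro hy
  obtain ⟨-, U, hyU, hU, -, H, -⟩ := h
  have hmem : q ⁻¹' U ∈ (𝒰 : Filter E) := hy (hU.mem_nhds hyU)
  obtain ⟨t, ht⟩ := 𝒰.nonempty_of_mem hmem
  exact isEmptyElim (H ⟨t, ht⟩).2

/-- **A covering map with finite fibres is proper** (converse companion of Forster §4 Thm. 4.22).
[folklore] -/
theorem IsCoveringMap.isProperMap_of_finite (hq : IsCoveringMap q) (hfin : ∀ y, (q ⁻¹' {y}).Finite) :
    IsProperMap q := by
  classical
  rw [isProperMap_iff_ultrafilter]
  refine ⟨hq.continuous, fun 𝒰 y hy ↦ ?_⟩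
  rcases (q ⁻¹' {y}).eq_empty_or_nonempty with hemp | hne
  · haveI : IsEmpty (q ⁻¹' {y}) := by rw [hemp]; infer_instance
    exact absurd hy (IsEvenlyCovered.not_tendsto_of_isEmpty (hq y) 𝒰)
  haveI : Nonempty (q ⁻¹' {y}) := hne.to_subtype
  haveI : Finite (q ⁻¹' {y}) := (hfin y).to_subtype
  set t := (hq y).toTrivialization with ht
  have hyt : y ∈ t.baseSet := (hq y).mem_toTrivialization_baseSet
  have hsrc : t.source ∈ (𝒰 : Filter E) := by
    rw [t.source_eq]
    exact hy (t.open_baseSet.mem_nhds hyt)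
  -- the ultrafilter concentrates on one sheet
  obtain ⟨i, hi⟩ : ∃ i : q ⁻¹' {y}, {e | e ∈ t.source ∧ (t e).2 = i} ∈ (𝒰 : Filter E) := by
    have hcover : t.source ⊆ ⋃ i ∈ (univ : Set (q ⁻¹' {y})), {e | e ∈ t.source ∧ (t e).2 = i} :=
      fun e he ↦ mem_biUnion (mem_univ (t e).2) ⟨he, rfl⟩
    have hmem := (Ultrafilter.finite_biUnion_mem_iff finite_univ).1 (mem_of_superset hsrc hcover)
    obtain ⟨i, -, hi⟩ := hmem
    exact ⟨i, hi⟩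
  -- and converges to the point of that sheet over `y`
  have hyi : (y, i) ∈ t.target := by rw [t.mem_target]; exact hyt
  refine ⟨t.toOpenPartialHomeomorph.symm (y, i), t.proj_symm_apply hyi, ?_⟩
  have h1 : Tendsto (fun e ↦ (t e).1) (𝒰 : Filter E) (𝓝 y) := by
    refine hy.congr' ?_
    filter_upwards [hsrc] with e he
    exact (t.coe_fst he).symm
  have h2 : Tendsto (fun e ↦ (t e).2) (𝒰 : Filter E) (𝓝 i) := by
    refine tendsto_const_nhds.congr' ?_
    filter_upwards [hi] with e he
    exact he.2.symm
  have h12 : Tendsto t (𝒰 : Filter E) (𝓝 (y, i)) := by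
    have h := h1.prodMk_nhds h2
    simpa only [Prod.mk.eta] using h
  have h3 : Tendsto (t.toOpenPartialHomeomorph.symm ∘ t) (𝒰 : Filter E) (𝓝 (t.toOpenPartialHomeomorph.symm (y, i))) :=
    (t.toOpenPartialHomeomorph.continuousAt_symm hyi).tendsto.comp h12
  have h4 : (t.toOpenPartialHomeomorph.symm ∘ t) =ᶠ[(𝒰 : Filter E)] id := by
    filter_upwards [hsrc] with e he
    exact t.toOpenPartialHomeomorph.left_inv he
  exact tendsto_id'.1 (h3.congr' h4)

end Literature.Topology.CoveringSpaces
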